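import Summits.AtomisticToContinuum.Crystallization.Theorems.ReggeStarCoercivityDefectFreeCrystallizesPalmDefs
import Summits.AtomisticToContinuum.Crystallization.Theorems.ReggeStarCoercivityDefectFreeCrystallizesChartTransferLink

/-!
# Two-shell rigidity at tolerance `1/20`: `stub_chartTransfer` (R1a3 of line `palm-good-law`, crux stmt-AtomisticToContinuum-13603, part 2/2)

The registered stub R1a3 of the lead-c4 skeleton `Cruxes/DefectFreeCrystallizes/Lines/palm_good_law.lean` (v15), in the format
of crux 9227's transfer lemma `Charts.sqNormInt_transfer` but at per-point tolerance `a/20`, where the spectrum-gap argument of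
9227 (two readings at `a/50`) is dead: for chart data of the R1a1 format with exact links at every point, two bonded points
`x ~ y` and two points `z, z'`, each of which is `x` (label `0`) or a labelled neighbour of `x` AND `y` (label `0`) or a labelled
neighbour of `y`, have the same squared label distance read at `y` as at `x`.

Proof (lead c5).  Exact links reduce everything to pairs of COMMON neighbours `z, z' ∈ N(x) ∩ N(y)`, whose labels form the link
of the bond label at either end (`adj_centre_of_bond`), related by the link transport `s ↦ zlab y (nb x s)` (injective, contact
preserving and reflecting; part 1).  The link read at `x` is FCC-like iff the link read at `y` is (`like_of_like`: otherwise the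
doubly-touching label `c` of the basal table at `y` would lie in the images of two disjoint touching pairs of the link at `x`).
HCP-basal at both ends: the transport maps `c ↦ c`, `i ↦ i`, `{e₁, e₂} ↦ {e₁, e₂}` (contact roles), so the table values agree.
FCC-like at both ends: a non-touching pair reads `36` or `54` at each end; if the readings differ, the row partner of the pair
reads the complementary values (`like_rowsum` at both ends), so one pair reads `(36 at x, 54 at y)` and the other
`(54 at x, 36 at y)`, which `metric_kill` excludes (`b(√3 − 1/10) ≤ a(√2 + 1/10)` and `a(√3 − 1/10) ≤ b(√2 + 1/10)` add up to
`√3 − √2 ≤ 1/5`).  No numerics beyond `sqrt_bounds`; the `∀ x ∈ S, SetGood S x` hypothesis of the registered signature is not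
used.  All `[folklore]`.
-/

namespace Summit.AtomisticToContinuum.Crystallization.Theorems.PalmGoodLaw.ChartTransfer

open Literature.Geometry.DiscreteGeometry Literature.MathematicalPhysics.StatisticalMechanics
open Summit.AtomisticToContinuum.Crystallization.Theorems.PalmGoodLaw (SetGood)
open Summit.AtomisticToContinuum.Crystallization.Theorems.PalmUnimodularRigidityShellsToBarlowChart (fcc3Int)

/-! ## Type transport and the core transfer -/

section Main

open Summit.AtomisticToContinuum.Crystallization.Theorems.PalmUnimodularRigidityShellsToBarlowChart
  (zlab sqNormInt_sub_comm sqNormInt_neg)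

variable {S : Set (EuclideanSpace ℝ (Fin 3))} {ac : EuclideanSpace ℝ (Fin 3) → ℝ}
  {Pc : EuclideanSpace ℝ (Fin 3) → Finset (Fin 3 → ℤ)}
  {Ac : EuclideanSpace ℝ (Fin 3) → (EuclideanSpace ℝ (Fin 3) →ₗᵢ[ℝ] EuclideanSpace ℝ (Fin 3))}
  {nb : EuclideanSpace ℝ (Fin 3) → (Fin 3 → ℤ) → EuclideanSpace ℝ (Fin 3)}

variable (hch : ∀ x ∈ S, (Pc x = fcc3Int ∨ Pc x = hcpInt) ∧ 9 / 10 ≤ ac x ∧ ac x ≤ 11 / 10 ∧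
    Set.BijOn (nb x) (↑(Pc x) : Set (Fin 3 → ℤ)) {y | y ∈ S ∧ (0 < dist x y ∧ dist x y < 6 / 5)} ∧
    (∀ t ∈ Pc x, dist (nb x t) (x + (ac x * (Real.sqrt 18)⁻¹) • Ac x (intVec t)) ≤ ac x / 20) ∧
    (∀ t ∈ Pc x, ∀ t' ∈ Pc x,
      ((0 < dist (nb x t) (nb x t') ∧ dist (nb x t) (nb x t') < 6 / 5) ↔ sqNormInt (t - t') = 18)))
include hch

/-- **Type transport.**  If the link of the bond `x ~ y` read at `x` is FCC-like, so is the link read at `y`: otherwise the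
basal table at `y` would put its doubly-touching label `c` in the images of two disjoint touching pairs of the link at `x`.
[folklore] -/
theorem like_of_like {x y : EuclideanSpace ℝ (Fin 3)} (hx : x ∈ S) (hy : y ∈ S) (hxy : 0 < dist x y ∧ dist x y < 6 / 5)
    (hF : Pc x = fcc3Int ∨ zlab Pc nb x y 0 + zlab Pc nb x y 1 + zlab Pc nb x y 2 ≠ 0)
    {t : Fin 3 → ℤ} (ht : t ∈ Pc x) (hadj : sqNormInt (t - zlab Pc nb x y) = 18) :
    Pc y = fcc3Int ∨ zlab Pc nb y x 0 + zlab Pc nb y x 1 + zlab Pc nb y x 2 ≠ 0 := by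
  by_contra hcon
  push Not at hcon
  obtain ⟨hyf, hbas⟩ := hcon
  have hyx : 0 < dist y x ∧ dist y x < 6 / 5 := by rw [dist_comm]; exact hxy
  have hPy : Pc y = hcpInt := ((hch y hy).1).resolve_left hyf
  obtain ⟨hu₀, -⟩ := lab_centre hch hy hx hyx
  obtain ⟨c, -, i, -, e₁, -, e₂, -, -, -, -, -, -, -, hci, h12, h1i, h2i, hcov⟩ :=
    link_table_hcp_basal _ (hPy ▸ hu₀) hbas
  have hP := (hch x hx).1
  obtain ⟨ht₀, -⟩ := lab_centre hch hx hy hxy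
  -- partner `r` of `t`; a non-touching companion `t'` of `t` and its partner `r'`
  obtain ⟨r, hr, hr₀, htr⟩ := like_partner hP ht₀ hF ht hadj
  obtain ⟨t', ht', ht'₀, ht't, hna⟩ := like_nonpartner hP ht₀ hF ht hadj
  obtain ⟨r', hr', hr'₀, ht'r'⟩ := like_partner hP ht₀ hF ht' ht'₀
  -- images at `y` lie in the basal table
  have mem : ∀ {s : Fin 3 → ℤ}, s ∈ Pc x → sqNormInt (s - zlab Pc nb x y) = 18 →
      (zlab Pc nb y (nb x s) = c ∨ zlab Pc nb y (nb x s) = i ∨ zlab Pc nb y (nb x s) = e₁ ∨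
        zlab Pc nb y (nb x s) = e₂) := by
    intro s hs hs₀
    obtain ⟨hφ, -, hφ₀⟩ := link_map hch hx hy hxy hs hs₀
    exact hcov _ (hPy ▸ hφ) hφ₀
  have a1 : sqNormInt (zlab Pc nb y (nb x t) - zlab Pc nb y (nb x r)) = 18 :=
    (link_adj_iff hch hx hy hxy ht hr hadj hr₀).2 htr
  have a2 : sqNormInt (zlab Pc nb y (nb x t') - zlab Pc nb y (nb x r')) = 18 :=
    (link_adj_iff hch hx hy hxy ht' hr' ht'₀ hr'₀).2 ht'r'
  have c1 := basal_adj_cases hci h12 h1i h2i (mem ht hadj) (mem hr hr₀) a1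
  have c2 := basal_adj_cases hci h12 h1i h2i (mem ht' ht'₀) (mem hr' hr'₀) a2
  rcases c1 with h1 | h1 <;> rcases c2 with h2 | h2
  · exact ht't (link_inj hch hx hy hxy ht' ht ht'₀ hadj (h2.trans h1.symm))
  · have h := link_inj hch hx hy hxy ht hr' hadj hr'₀ (h1.trans h2.symm)
    apply hna
    rw [sqNormInt_sub_comm, h]
    exact ht'r'
  · have h := link_inj hch hx hy hxy hr ht' hr₀ ht'₀ (h1.trans h2.symm)
    exact hna (h ▸ htr)
  · have hrr := link_inj hch hx hy hxy hr hr' hr₀ hr'₀ (h1.trans h2.symm)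
    have h1' : sqNormInt (r - t) = 18 := by rw [sqNormInt_sub_comm]; exact htr
    have h2' : sqNormInt (r - t') = 18 := by rw [sqNormInt_sub_comm, hrr]; exact ht'r'
    exact ht't (like_onePartner hP ht₀ hF hr ht ht' hr₀ hadj ht'₀ h1' h2').symm

/-- **The core transfer**: two common labelled neighbours `z = nb x t = nb y u`, `z' = nb x t' = nb y u'` of the bonded pair
`x ~ y` have the same squared label distance at `y` as at `x`. [folklore] -/
theorem core {x y : EuclideanSpace ℝ (Fin 3)} (hx : x ∈ S) (hy : y ∈ S) (hxy : 0 < dist x y ∧ dist x y < 6 / 5)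
    {t t' : Fin 3 → ℤ} (ht : t ∈ Pc x) (ht' : t' ∈ Pc x) {u u' : Fin 3 → ℤ} (hu : u ∈ Pc y) (hu' : u' ∈ Pc y)
    (hz : nb x t = nb y u) (hz' : nb x t' = nb y u') : sqNormInt (u - u') = sqNormInt (t - t') := by
  by_cases htt : t = t'
  · subst htt
    have : u = u' := nb_inj hch hy hu hu' (by rw [← hz, ← hz'])
    rw [this, sub_self, sub_self]
  have hzz : nb x t ≠ nb x t' := fun h => htt (nb_inj hch hx ht ht' h)
  have huu : u ≠ u' := fun h => hzz (by rw [hz, hz', h])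
  by_cases hb : dist (nb x t) (nb x t') < 6 / 5
  · have hpos : 0 < dist (nb x t) (nb x t') := dist_pos.2 hzz
    rw [(links hch hx ht ht').1 ⟨hpos, hb⟩,
      (links hch hy hu hu').1 (by rw [← hz, ← hz']; exact ⟨hpos, hb⟩)]
  have hna : sqNormInt (t - t') ≠ 18 := fun h => hb ((links hch hx ht ht').2 h).2
  have hnau : sqNormInt (u - u') ≠ 18 := fun h => hb (by
    have := ((links hch hy hu hu').2 h).2; rwa [← hz, ← hz'] at this)
  -- the two links
  have hyx : 0 < dist y x ∧ dist y x < 6 / 5 := by rw [dist_comm]; exact hxy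
  obtain ⟨ht₀, -⟩ := lab_centre hch hx hy hxy
  obtain ⟨hu₀, -⟩ := lab_centre hch hy hx hyx
  have hadj : sqNormInt (t - zlab Pc nb x y) = 18 :=
    adj_centre_of_bond hch hx hy hxy ht (by rw [hz, dist_comm]; exact (nb_mem hch hy hu).2)
  have hadj' : sqNormInt (t' - zlab Pc nb x y) = 18 :=
    adj_centre_of_bond hch hx hy hxy ht' (by rw [hz', dist_comm]; exact (nb_mem hch hy hu').2)
  have hφt : zlab Pc nb y (nb x t) = u := by rw [hz, lab_nb hch hy hu]
  have hφt' : zlab Pc nb y (nb x t') = u' := by rw [hz', lab_nb hch hy hu']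
  have huadj : sqNormInt (u - zlab Pc nb y x) = 18 := by
    rw [← hφt]; exact (link_map hch hx hy hxy ht hadj).2.2
  have hu'adj : sqNormInt (u' - zlab Pc nb y x) = 18 := by
    rw [← hφt']; exact (link_map hch hx hy hxy ht' hadj').2.2
  have hP := (hch x hx).1
  have hPy := (hch y hy).1
  by_cases hF : Pc x = fcc3Int ∨ zlab Pc nb x y 0 + zlab Pc nb x y 1 + zlab Pc nb x y 2 ≠ 0
  · -- FCC-like at both ends
    have hFy := like_of_like hch hx hy hxy hF ht hadj
    obtain ⟨s₃, hs₃, hs₃₀, hs₃t, hs₃t', hna₃⟩ := like_rowpartner hP ht₀ hF ht ht' hadj hadj' htt hna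
    obtain ⟨hφ₃, hφs₃, hφ₃₀⟩ := link_map hch hx hy hxy hs₃ hs₃₀
    have hvu : zlab Pc nb y (nb x s₃) ≠ u := fun h =>
      hs₃t (link_inj hch hx hy hxy hs₃ ht hs₃₀ hadj (h.trans hφt.symm))
    have hvu' : zlab Pc nb y (nb x s₃) ≠ u' := fun h =>
      hs₃t' (link_inj hch hx hy hxy hs₃ ht' hs₃₀ hadj' (h.trans hφt'.symm))
    have hnav : sqNormInt (u - zlab Pc nb y (nb x s₃)) ≠ 18 := by
      rw [← hφt]; exact fun h => hna₃ ((link_adj_iff hch hx hy hxy ht hs₃ hadj hs₃₀).1 h)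
    have sx := like_rowsum hP ht₀ hF ht ht' hs₃ hadj hadj' hs₃₀ htt (Ne.symm hs₃t) (Ne.symm hs₃t') hna hna₃
    have sy := like_rowsum hPy hu₀ hFy hu hu' hφ₃ huadj hu'adj hφ₃₀ huu hvu.symm hvu'.symm hnau hnav
    have ha : 0 < ac x := by linarith [(hch x hx).2.1]
    have ha' : 0 < ac y := by linarith [(hch y hy).2.1]
    have r1x := reading hch hx ht ht'
    have r1y := reading hch hy hu hu'
    rw [← hz, ← hz'] at r1y
    have r2x := reading hch hx ht hs₃
    have r2y := reading hch hy hu hφ₃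
    rw [← hz, hφs₃] at r2y
    rcases like_pair hP ht₀ hF ht ht' hadj hadj' htt hna with hD | hD <;>
      rcases like_pair hPy hu₀ hFy hu hu' huadj hu'adj huu hnau with hD' | hD'
    · rw [hD, hD']
    · exfalso
      have hE : sqNormInt (t - s₃) = 54 := by omega
      have hE' : sqNormInt (u - zlab Pc nb y (nb x s₃)) = 36 := by omega
      rw [hD] at r1x; rw [hD'] at r1y; rw [hE] at r2x; rw [hE'] at r2y
      push_cast at r1x r1y r2x r2y
      exact metric_kill ha ha' r1x r1y r2x r2y
    · exfalso
      have hE : sqNormInt (t - s₃) = 36 := by omega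
      have hE' : sqNormInt (u - zlab Pc nb y (nb x s₃)) = 54 := by omega
      rw [hD] at r1x; rw [hD'] at r1y; rw [hE] at r2x; rw [hE'] at r2y
      push_cast at r1x r1y r2x r2y
      exact metric_kill ha ha' r2x r2y r1x r1y
    · rw [hD, hD']
  · -- HCP-basal at both ends
    push Not at hF
    obtain ⟨hxf, hbas⟩ := hF
    have hPx : Pc x = hcpInt := hP.resolve_left hxf
    have hFy : ¬ (Pc y = fcc3Int ∨ zlab Pc nb y x 0 + zlab Pc nb y x 1 + zlab Pc nb y x 2 ≠ 0) := by
      intro hFy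
      rcases like_of_like hch hy hx hyx hFy hu huadj with h | h
      · exact hxf h
      · exact h hbas
    push Not at hFy
    obtain ⟨hyf, hbas'⟩ := hFy
    have hPy' : Pc y = hcpInt := hPy.resolve_left hyf
    obtain ⟨c, hc, i, hi, e₁, he₁, e₂, he₂, hc₀, hi₀, he₁₀, he₂₀, hce₁, hce₂, hci, h12, h1i, h2i, hcov⟩ :=
      link_table_hcp_basal _ (hPx ▸ ht₀) hbas
    obtain ⟨c', -, i', -, e₁', -, e₂', -, -, -, -, -, hce₁', hce₂', hci', h12', h1i', h2i', hcov'⟩ :=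
      link_table_hcp_basal _ (hPy' ▸ hu₀) hbas'
    have hcx : c ∈ Pc x := hPx ▸ hc
    have hix : i ∈ Pc x := hPx ▸ hi
    have he₁x : e₁ ∈ Pc x := hPx ▸ he₁
    have he₂x : e₂ ∈ Pc x := hPx ▸ he₂
    -- images of link labels lie in the table at `y`
    have memφ : ∀ {s : Fin 3 → ℤ}, s ∈ Pc x → sqNormInt (s - zlab Pc nb x y) = 18 →
        (zlab Pc nb y (nb x s) = c' ∨ zlab Pc nb y (nb x s) = i' ∨ zlab Pc nb y (nb x s) = e₁' ∨
          zlab Pc nb y (nb x s) = e₂') := by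
      intro s hs hs₀
      obtain ⟨hφ, -, hφ₀⟩ := link_map hch hx hy hxy hs hs₀
      exact hcov' _ (hPy' ▸ hφ) hφ₀
    -- distinctness in the table at `x`
    have hne_ci : c ≠ i := by intro h; rw [h] at hci; simp [sub_self, sqNormInt] at hci
    have hne_12 : e₁ ≠ e₂ := by intro h; rw [h] at h12; simp [sub_self, sqNormInt] at h12
    have hne_c1 : c ≠ e₁ := by intro h; rw [h] at hce₁; simp [sub_self, sqNormInt] at hce₁
    have hne_c2 : c ≠ e₂ := by intro h; rw [h] at hce₂; simp [sub_self, sqNormInt] at hce₂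
    have hne_1i : e₁ ≠ i := by intro h; rw [h] at h1i; simp [sub_self, sqNormInt] at h1i
    have hne_2i : e₂ ≠ i := by intro h; rw [h] at h2i; simp [sub_self, sqNormInt] at h2i
    -- transported contacts
    have ac1 : sqNormInt (zlab Pc nb y (nb x c) - zlab Pc nb y (nb x e₁)) = 18 :=
      (link_adj_iff hch hx hy hxy hcx he₁x hc₀ he₁₀).2 hce₁
    have ac2 : sqNormInt (zlab Pc nb y (nb x c) - zlab Pc nb y (nb x e₂)) = 18 :=
      (link_adj_iff hch hx hy hxy hcx he₂x hc₀ he₂₀).2 hce₂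
    -- `φ c = c'`
    have hφc : zlab Pc nb y (nb x c) = c' := by
      by_contra hne
      have k1 : zlab Pc nb y (nb x e₁) = c' :=
        (basal_adj_cases hci' h12' h1i' h2i' (memφ hcx hc₀) (memφ he₁x he₁₀) ac1).resolve_left hne
      have k2 : zlab Pc nb y (nb x e₂) = c' :=
        (basal_adj_cases hci' h12' h1i' h2i' (memφ hcx hc₀) (memφ he₂x he₂₀) ac2).resolve_left hne
      exact hne_12 (link_inj hch hx hy hxy he₁x he₂x he₁₀ he₂₀ (k1.trans k2.symm))
    -- `φ i = i'`
    have hφi : zlab Pc nb y (nb x i) = i' := by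
      rcases memφ hix hi₀ with h | h | h | h
      · exact absurd (link_inj hch hx hy hxy hix hcx hi₀ hc₀ (h.trans hφc.symm)) hne_ci.symm
      · exact h
      · exfalso
        have : sqNormInt (zlab Pc nb y (nb x c) - zlab Pc nb y (nb x i)) = 18 := by rw [hφc, h]; exact hce₁'
        have := (link_adj_iff hch hx hy hxy hcx hix hc₀ hi₀).1 this
        omega
      · exfalso
        have : sqNormInt (zlab Pc nb y (nb x c) - zlab Pc nb y (nb x i)) = 18 := by rw [hφc, h]; exact hce₂'
        have := (link_adj_iff hch hx hy hxy hcx hix hc₀ hi₀).1 this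
        omega
    -- `φ e₁, φ e₂ ∈ {e₁', e₂'}`, distinct
    have hφe : ∀ {e : Fin 3 → ℤ}, e ∈ Pc x → sqNormInt (e - zlab Pc nb x y) = 18 → e ≠ c → e ≠ i →
        (zlab Pc nb y (nb x e) = e₁' ∨ zlab Pc nb y (nb x e) = e₂') := by
      intro e he he₀ hec hei
      rcases memφ he he₀ with h | h | h | h
      · exact absurd (link_inj hch hx hy hxy he hcx he₀ hc₀ (h.trans hφc.symm)) hec
      · exact absurd (link_inj hch hx hy hxy he hix he₀ hi₀ (h.trans hφi.symm)) hei
      · exact Or.inl h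
      · exact Or.inr h
    have hφ12 : zlab Pc nb y (nb x e₁) ≠ zlab Pc nb y (nb x e₂) := fun h =>
      hne_12 (link_inj hch hx hy hxy he₁x he₂x he₁₀ he₂₀ h)
    have hφe₁ := hφe he₁x he₁₀ hne_c1.symm hne_1i
    have hφe₂ := hφe he₂x he₂₀ hne_c2.symm hne_2i
    -- values of the transported pairs
    have v1 : sqNormInt (zlab Pc nb y (nb x e₁) - zlab Pc nb y (nb x i)) = 36 := by
      rw [hφi]; rcases hφe₁ with h | h <;> rw [h]
      · exact h1i'
      · exact h2i'
    have v2 : sqNormInt (zlab Pc nb y (nb x e₂) - zlab Pc nb y (nb x i)) = 36 := by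
      rw [hφi]; rcases hφe₂ with h | h <;> rw [h]
      · exact h1i'
      · exact h2i'
    have v12 : sqNormInt (zlab Pc nb y (nb x e₁) - zlab Pc nb y (nb x e₂)) = 48 := by
      rcases hφe₁ with h₁ | h₁ <;> rcases hφe₂ with h₂ | h₂
      · exact absurd (h₁.trans h₂.symm) hφ12
      · rw [h₁, h₂]; exact h12'
      · rw [h₁, h₂, sqNormInt_sub_comm]; exact h12'
      · exact absurd (h₁.trans h₂.symm) hφ12
    have vci : sqNormInt (zlab Pc nb y (nb x c) - zlab Pc nb y (nb x i)) = 54 := by rw [hφc, hφi]; exact hci'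
    -- case analysis on `t, t'` in the table at `x`
    rw [← hφt, ← hφt']
    have htc := hcov t (hPx ▸ ht) hadj
    have ht'c := hcov t' (hPx ▸ ht') hadj'
    rcases htc with rfl | rfl | rfl | rfl <;> rcases ht'c with rfl | rfl | rfl | rfl
    · exact absurd rfl htt
    · rw [vci, hci]
    · exact absurd hce₁ hna
    · exact absurd hce₂ hna
    · rw [sqNormInt_sub_comm, vci, sqNormInt_sub_comm, hci]
    · exact absurd rfl htt
    · rw [sqNormInt_sub_comm, v1, sqNormInt_sub_comm, h1i]
    · rw [sqNormInt_sub_comm, v2, sqNormInt_sub_comm, h2i]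
    · exact absurd (by rw [sqNormInt_sub_comm]; exact hce₁) hna
    · rw [v1, h1i]
    · exact absurd rfl htt
    · rw [v12, h12]
    · exact absurd (by rw [sqNormInt_sub_comm]; exact hce₂) hna
    · rw [v2, h2i]
    · rw [sqNormInt_sub_comm, v12, sqNormInt_sub_comm, h12]
    · exact absurd rfl htt

end Main


section Stub

open Summit.AtomisticToContinuum.Crystallization.Theorems.PalmUnimodularRigidityShellsToBarlowChart (sqNormInt_neg)

/-- **R1a3 `stub_chartTransfer` of line `palm-good-law` (crux stmt-AtomisticToContinuum-13603).**  TWO-SHELL RIGIDITY AT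
TOLERANCE `1/20` in the format of 9227's transfer lemma: for chart data of the R1a1 format WITH exact links at every point of an
everywhere-`SetGood` set, two bonded points `x ~ y` and two points `z, z'` each of which is `x` (label `0`) or a labelled
neighbour of `x` AND `y` (label `0`) or a labelled neighbour of `y` have the same squared label distance read at `y` as at `x`.
Proof: the link `{x, y} ∪ (N(x) ∩ N(y))` has two labelled metric types (FCC-like: contact graph on the four common neighbours a
perfect matching, non-touching pairs `36/54`; HCP-basal: a path plus an isolated label, non-touching pairs `36/36/48/54` fixed by
the contact roles); the type transports along the bond (`like_of_like`), the HCP-basal values transport with the roles, and the only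
non-ideal FCC-like assignment (the `36/54` matchings swapped) is excluded by the scale-product inequality `metric_kill`. -/
theorem stub_chartTransfer :
    ∀ S : Set (EuclideanSpace ℝ (Fin 3)), (∀ x ∈ S, SetGood S x) →
      ∀ (ac : EuclideanSpace ℝ (Fin 3) → ℝ) (Pc : EuclideanSpace ℝ (Fin 3) → Finset (Fin 3 → ℤ))
        (Ac : EuclideanSpace ℝ (Fin 3) → (EuclideanSpace ℝ (Fin 3) →ₗᵢ[ℝ] EuclideanSpace ℝ (Fin 3)))
        (nb : EuclideanSpace ℝ (Fin 3) → (Fin 3 → ℤ) → EuclideanSpace ℝ (Fin 3)),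
        (∀ x ∈ S, (Pc x = fcc3Int ∨ Pc x = hcpInt) ∧ 9 / 10 ≤ ac x ∧ ac x ≤ 11 / 10 ∧
          Set.BijOn (nb x) (↑(Pc x) : Set (Fin 3 → ℤ))
            {y | y ∈ S ∧ (0 < dist x y ∧ dist x y < 6 / 5)} ∧
          (∀ t ∈ Pc x, dist (nb x t) (x + (ac x * (Real.sqrt 18)⁻¹) • Ac x (intVec t)) ≤ ac x / 20) ∧
          (∀ t ∈ Pc x, ∀ t' ∈ Pc x,
            ((0 < dist (nb x t) (nb x t') ∧ dist (nb x t) (nb x t') < 6 / 5) ↔ sqNormInt (t - t') = 18))) →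
        ∀ x ∈ S, ∀ y ∈ S, (0 < dist x y ∧ dist x y < 6 / 5) →
          ∀ (z z' : EuclideanSpace ℝ (Fin 3)) (t t' u u' : Fin 3 → ℤ),
            ((t = 0 ∧ z = x) ∨ (t ∈ Pc x ∧ z = nb x t)) → ((t' = 0 ∧ z' = x) ∨ (t' ∈ Pc x ∧ z' = nb x t')) →
            ((u = 0 ∧ z = y) ∨ (u ∈ Pc y ∧ z = nb y u)) → ((u' = 0 ∧ z' = y) ∨ (u' ∈ Pc y ∧ z' = nb y u')) →
            sqNormInt (u - u') = sqNormInt (t - t') := by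
  intro S _ ac Pc Ac nb hch' x hx y hy hxy z z' t t' u u' hz hz' hu hu'
  have hxy_ne : x ≠ y := fun h => by rw [h, dist_self] at hxy; exact lt_irrefl _ hxy.1
  rcases hz with ⟨rfl, rfl⟩ | ⟨ht, rfl⟩ <;> rcases hu with ⟨rfl, hzy⟩ | ⟨hu, hzu⟩
  · exact absurd hzy hxy_ne
  · rcases hz' with ⟨rfl, rfl⟩ | ⟨ht', rfl⟩ <;> rcases hu' with ⟨rfl, hzy'⟩ | ⟨hu', hzu'⟩
    · exact absurd hzy' hxy_ne
    · have : u = u' := nb_inj hch' hy hu hu' (by rw [← hzu, ← hzu'])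
      rw [this, sub_self, sub_self]
    · rw [sub_zero, zero_sub, sqNormInt_neg, sqNormInt_label hch' hy hu, sqNormInt_label hch' hx ht']
    · rw [zero_sub, sqNormInt_neg, sqNormInt_label hch' hx ht']
      apply (links hch' hy hu hu').1
      rw [← hzu, ← hzu']
      exact (nb_mem hch' hx ht').2
  · rcases hz' with ⟨rfl, rfl⟩ | ⟨ht', rfl⟩ <;> rcases hu' with ⟨rfl, hzy'⟩ | ⟨hu', hzu'⟩
    · exact absurd hzy' hxy_ne
    · rw [sub_zero, zero_sub, sqNormInt_neg, sqNormInt_label hch' hy hu', sqNormInt_label hch' hx ht]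
    · have : t = t' := nb_inj hch' hx ht ht' (by rw [hzy, hzy'])
      rw [this, sub_self, sub_self]
    · rw [zero_sub, sqNormInt_neg, sqNormInt_label hch' hy hu']
      symm
      apply (links hch' hx ht ht').1
      rw [hzy, hzu']
      exact (nb_mem hch' hy hu').2
  · rcases hz' with ⟨rfl, rfl⟩ | ⟨ht', rfl⟩ <;> rcases hu' with ⟨rfl, hzy'⟩ | ⟨hu', hzu'⟩
    · exact absurd hzy' hxy_ne
    · rw [sub_zero, sqNormInt_label hch' hx ht]
      apply (links hch' hy hu hu').1
      rw [← hzu, ← hzu', dist_comm]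
      exact (nb_mem hch' hx ht).2
    · rw [sub_zero, sqNormInt_label hch' hy hu]
      symm
      apply (links hch' hx ht ht').1
      rw [hzy', hzu, dist_comm]
      exact (nb_mem hch' hy hu).2
    · exact core hch' hx hy hxy ht ht' hu hu' hzu hzu'

end Stub

end Summit.AtomisticToContinuum.Crystallization.Theorems.PalmGoodLaw.ChartTransfer
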